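import Literature.AnabelianGeometry.EtaleTheta.Discharge.Sec2ProfiniteYTheta
import Literature.AnabelianGeometry.SemiGraphs.TemperedCompactImage
import Mathlib.GroupTheory.Abelianization.Defs
import HarnessLib

/-!
# [EtTh] §1 pp. 12–13: «(Δ^tp_Y)^Θ is profinite», «Δ_Θ (≅ Ẑ(1))» — COMPACTNESS ON THE Θ-SIDE DERIVED
# from the `Π_X`-side binder `hYcl` and temperedness of `Π^tp_X` (proof-only companion; GAP-LEDGER rows
# G-w4d021-2 / G-w5d187-1)

S. Mochizuki, *The étale theta function and its Frobenioid-theoretic manifestations*, Publ. RIMS **45**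
(2009) [EtTh], §1 PRIMS PDF pp. 12–13: «we have a natural exact sequence of abelian profinite groups
`1 → Δ_Θ → (Δ^tp_Y)^Θ → (Δ^tp_Y)^ell → 1`», «`(Ẑ(1) ≅) Δ_Θ`» [cite: MochizukiEtTh2009, §1 p.12]; the
tempered-group input is [SemiAnbd] Def. 3.1 (i) / Ex. 3.10 (`Π^tp_X` tempered, Galois-countable).  Layer L2
of the abc-iut cell, seat abc-iut-w5-d111 (gen 3).  PROOF-ONLY, no definition; nothing of the root interface
`Setting.lean` (abc-iut-L2-t1) is touched.

THE SITUATION.  The root interface `ThetaSetting` gives `(Π^tp_X)^Θ = GtpTheta` an ABSTRACT topology of which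
only `Continuous toTheta` is recorded.  Two candidate root clauses about `(Δ^tp_Y)^Θ` are carried as binders by
the cell: the `Π_X`-side `hYcl : (ι Δ^tp_Y)⁻ ≤ ι Δ^tp_Y ⊔ [[Δ_X,Δ_X],Δ_X]⁻` («the image of `Δ^tp_Y` in
`Δ^Θ_X = Δ_X/[[Δ_X,Δ_X],Δ_X]⁻` is closed», GAP row G-w4d021-2; NOT derivable from `Setting.lean` v3 +
`IsEtThOrigin`, abc-iut-L2-t1 `SettingModel.hYcl_not_derivable`, p421746) and the `Θ`-side
«`Δ_Θ` is compact and `(Π^tp_X)^Θ` is Hausdorff» (binders `hΔ`, `[T2Space D.GtpTheta]` of the [IUTchII]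
Prop. 2.2 (ii) / Cor. 1.12 / Prop. 3.1 (ii) model files `IotaInvariantThetaInfty*`, GAP row G-w5d187-1).
abc-iut-L5-t14's `ThetaSetting.closure_map_dtpY_le_of_isQuotientMap` proves Θ-side ⇒ Π_X-side (given
`IsQuotientMap toTheta`).  THIS FILE proves the converse WITHOUT any hypothesis on the topology of `GtpTheta`:

* `ThetaSetting.isCompact_dtpYTheta_of_closure_map_dtpY_le` — `Π^tp_X` tempered first-countable + `hYcl` ⇒
  `(Δ^tp_Y)^Θ = θ(Δ^tp_Y) ⊆ (Π^tp_X)^Θ` is COMPACT;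
* `ThetaSetting.isCompact_deltaTheta_of_closure_map_dtpY_le` — same hypotheses ⇒ `Δ_Θ` is COMPACT (= `hΔ`);
* `ThetaSetting.t2Space_gtpTheta_of_isQuotientMap` / `t2Space_gtpEll_of_isQuotientMap` — the quotient-topology
  clause R3 (`IsThm16Origin.isQuotientMap_toTheta` / `_thetaToEll`, abc-iut-L2-t6) ⇒ `(Π^tp_X)^Θ`,
  `(Π^tp_X)^ell` Hausdorff (their kernels are preimages of closed subgroups of `Π_X`);
* packaging: `…_of_groupLevelData` (the §6 parameter bundle `d : D.toTemperedCurve.GroupLevelData` of ruling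
  η′ supplies temperedness + Galois-countability) and the equivalence
  `closure_map_dtpY_le_iff_isCompact_dtpYTheta` (under R3: `hYcl ↔ (Δ^tp_Y)^Θ compact`); at an origin setting
  `h : D.IsThm16Origin` (file `ThetaSettingOriginClauses.lean`, not imported here to keep this file light) the
  instance binder is `D.t2Space_gtpTheta_of_isQuotientMap h.isQuotientMap_toTheta`.

NET EFFECT for the root-clause bookkeeping: G-w5d187-1 («IsCompact Δ_Θ ∧ T2Space GtpTheta») FOLLOWS from
G-w4d021-2 (`hYcl`) + R3 + `GroupLevelData`; consumers of `hΔ` may write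
`D.isCompact_deltaTheta_of_groupLevelData d hYcl`.

MECHANISM (this seat's `SemiGraphs/TemperedCompactImage.lean`): with `K₃ := [[Δ_X,Δ_X],Δ_X]⁻` and
`ψ : Π^tp_X → Π_X/K₃`, the closed subgroup `Δ^tp_Y` (resp. `K₂ := ι⁻¹[Δ_X,Δ_X]⁻`) of the tempered,
first-countable `Π^tp_X` has CLOSED image under `ψ` — by `hYcl` (resp. by `hYcl` and
`[Δ_X,Δ_X]⁻ ≤ (ι[Δ^tp_X,Δ^tp_X])⁻ ≤ (ι Δ^tp_Y)⁻`, density of `ι Δ^tp_X` in `Δ_X`) — hence compact, so it maps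
OPENLY onto it (open mapping theorem for tempered groups, p416385); `toTheta` kills `Δ^tp_Y ∩ Ker ψ = Ker toTheta`
(root field `ker_toTheta`), so `θ(Δ^tp_Y)` (resp. `θ(K₂) = Δ_Θ`, root field `ker_toEll`) is a continuous
image of the compact `ψ(Δ^tp_Y)` (resp. `[Δ_X,Δ_X]⁻/K₃`).
HONEST FRAMING: [EtTh]/[SemiAnbd] are refereed; nothing is asserted about the existence of the setting; no
side is taken on [IUTchIII] Cor. 3.12; typed ≠ proved (here: proved, classical topology).
-/

noncomputable section

namespace Literature.AnabelianGeometry.EtaleTheta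

open Literature.AnabelianGeometry.SemiGraphs
open _root_.Topology
open scoped Pointwise

namespace ThetaSetting

variable {p : ℕ} [Fact p.Prime] (D : ThetaSetting p)

/-! ### Elementary facts about `Δ^tp_Y` and `[Δ_X, Δ_X]` -/

/-- `Δ^tp_Y = Π^tp_Y ∩ Δ^tp_X` is closed in `Π^tp_X` (`Π^tp_Y = Ker(Π^tp_X ↠ Z)` is open, p. 12;
`Δ^tp_X = Ker(Π^tp_X → G_{ℚ_p})`). [cite: MochizukiEtTh2009, §1 p.12] -/
theorem isClosed_dtpY : IsClosed ((D.DtpY : Subgroup D.PiTemp) : Set D.PiTemp) := by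
  haveI : IsGalois ℚ_[p] (AlgebraicClosure ℚ_[p]) := {}
  haveI : T2Space (GQp p) := krullTopology_t2
  have h1 : IsClosed ((D.GtpY : Subgroup D.PiTemp) : Set D.PiTemp) :=
    Subgroup.isClosed_of_isOpen _ D.isOpen_ker_toZ
  have h2 : IsClosed ((D.DeltaTemp : Subgroup D.PiTemp) : Set D.PiTemp) := by
    change IsClosed ((D.aug : D.PiTemp → GQp p) ⁻¹' {1})
    exact isClosed_singleton.preimage D.aug.continuous
  show IsClosed (((D.GtpY ⊓ D.DeltaTemp : Subgroup D.PiTemp)) : Set D.PiTemp)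
  rw [Subgroup.coe_inf]
  exact h1.inter h2

/-- `[Δ^tp_X, Δ^tp_X] ⊆ Δ^tp_Y` (`Z ≅ ℤ` is abelian; `Δ^tp_X` is normal). [cite: MochizukiEtTh2009, §1 p.12] -/
theorem commutator_deltaTemp_le_dtpY : ⁅D.DeltaTemp, D.DeltaTemp⁆ ≤ D.DtpY := by
  haveI : D.DeltaTemp.Normal := MonoidHom.normal_ker D.aug.toMonoidHom
  show ⁅D.DeltaTemp, D.DeltaTemp⁆ ≤ D.GtpY ⊓ D.DeltaTemp
  refine le_inf ?_ (Subgroup.commutator_le_left _ _)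
  calc ⁅D.DeltaTemp, D.DeltaTemp⁆ ≤ commutator D.PiTemp := by
        rw [commutator_def]; exact Subgroup.commutator_mono le_top le_top
    _ ≤ D.toZ.ker := Abelianization.commutator_subset_ker D.toZ

/-- `[Δ_X, Δ_X]⁻ ≤ (ι Δ^tp_Y)⁻` in `Π_X`: `Δ_X` is the closure of `ι Δ^tp_X`, so `[Δ_X, Δ_X]` lies in the
closure of `ι [Δ^tp_X, Δ^tp_X] ⊆ ι Δ^tp_Y` ([SemiAnbd] §6 p. 69 «closure in `Π_{X_K}`»).
[cite: MochizukiEtTh2009, §1 p.12] -/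
theorem commutatorClosure_deltaHat_le_closure_map_dtpY :
    (⁅D.DeltaHat, D.DeltaHat⁆).topologicalClosure ≤
      (D.DtpY.map D.toHat.toMonoidHom).topologicalClosure := by
  refine Subgroup.topologicalClosure_minimal _ ?_ (Subgroup.isClosed_topologicalClosure _)
  calc ⁅D.DeltaHat, D.DeltaHat⁆
      ≤ (⁅D.DeltaTemp.map D.toHat.toMonoidHom, D.DeltaTemp.map D.toHat.toMonoidHom⁆).topologicalClosure :=
        commutator_topologicalClosure_le _ _
    _ = ((⁅D.DeltaTemp, D.DeltaTemp⁆).map D.toHat.toMonoidHom).topologicalClosure := by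
        rw [Subgroup.map_commutator]
    _ ≤ (D.DtpY.map D.toHat.toMonoidHom).topologicalClosure :=
        Subgroup.topologicalClosure_mono (Subgroup.map_mono D.commutator_deltaTemp_le_dtpY)

/-! ### Compactness of `(Δ^tp_Y)^Θ` and of `Δ_Θ` from `hYcl` -/

/-- **«(Δ^tp_Y)^Θ is profinite», `Π_X`-side ⇒ `Θ`-side** ([EtTh] pp. 12–13): if `Π^tp_X` is tempered with
first-countable topology and the image of `Δ^tp_Y` in `Δ_X/[[Δ_X,Δ_X],Δ_X]⁻` is closed (`hYcl`), then
`(Δ^tp_Y)^Θ = θ(Δ^tp_Y) ⊆ (Π^tp_X)^Θ` is COMPACT — for the abstract topology of `(Π^tp_X)^Θ` (only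
`Continuous toTheta` is used).  Converse of abc-iut-L5-t14's `closure_map_dtpY_le_of_isQuotientMap`.
[cite: MochizukiEtTh2009, §1 p.12] -/
theorem isCompact_dtpYTheta_of_closure_map_dtpY_le (hT : IsTempered D.PiTemp)
    [FirstCountableTopology D.PiTemp]
    (hYcl : (D.DtpY.map D.toHat.toMonoidHom).topologicalClosure ≤
      D.DtpY.map D.toHat.toMonoidHom ⊔ (⁅⁅D.DeltaHat, D.DeltaHat⁆, D.DeltaHat⁆).topologicalClosure) :
    IsCompact ((D.DtpYTheta : Subgroup D.GtpTheta) : Set D.GtpTheta) := by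
  haveI : CompactSpace D.PiHat := D.isProfiniteCompletion_toHat.compactSpace
  haveI : T2Space D.PiHat := D.isProfiniteCompletion_toHat.t2Space
  haveI hΔn : D.DeltaHat.Normal := SettingCompletion.deltaHat_normal D.toTemperedCurve
  haveI hK₃n : (⁅⁅D.DeltaHat, D.DeltaHat⁆, D.DeltaHat⁆).topologicalClosure.Normal :=
    Subgroup.is_normal_topologicalClosure _
  haveI hK₃c : IsClosed
      (((⁅⁅D.DeltaHat, D.DeltaHat⁆, D.DeltaHat⁆).topologicalClosure : Subgroup D.PiHat) : Set D.PiHat) :=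
    Subgroup.isClosed_topologicalClosure _
  set K₃ := (⁅⁅D.DeltaHat, D.DeltaHat⁆, D.DeltaHat⁆).topologicalClosure with hK₃
  set A := D.DtpY.map D.toHat.toMonoidHom with hA
  -- `ψ : Π^tp_X → Π_X/K₃`
  have hψc : Continuous ((QuotientGroup.mk' K₃).comp D.toHat.toMonoidHom) :=
    QuotientGroup.continuous_mk.comp D.toHat.continuous
  -- by `hYcl`, `A ⊔ K₃ = A⁻ ⊔ K₃` is closed (closed · compact)
  have hcl : IsClosed (((A ⊔ K₃ : Subgroup D.PiHat)) : Set D.PiHat) := by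
    have heq : A ⊔ K₃ = A.topologicalClosure ⊔ K₃ :=
      le_antisymm (sup_le_sup_right A.le_topologicalClosure _) (sup_le hYcl le_sup_right)
    rw [heq, Subgroup.mul_normal]
    exact (Subgroup.isClosed_topologicalClosure _).mul_right_of_isCompact hK₃c.isCompact
  -- hence `ψ(Δ^tp_Y)` is closed in `Π_X/K₃`
  have himg : IsClosed (((D.DtpY.map ((QuotientGroup.mk' K₃).comp D.toHat.toMonoidHom) :
      Subgroup (D.PiHat ⧸ K₃))) : Set (D.PiHat ⧸ K₃)) := by
    have h1 : (((D.DtpY.map ((QuotientGroup.mk' K₃).comp D.toHat.toMonoidHom) :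
        Subgroup (D.PiHat ⧸ K₃))) : Set (D.PiHat ⧸ K₃)) =
        QuotientGroup.mk '' ((A : Subgroup D.PiHat) : Set D.PiHat) := by
      rw [← Subgroup.map_map, Subgroup.coe_map]
      rfl
    rw [h1, ← (QuotientGroup.isQuotientMap_mk K₃).isClosed_preimage,
      QuotientGroup.preimage_image_mk_eq_mul, ← Subgroup.mul_normal]
    exact hcl
  -- `Δ^tp_Y ∩ Ker ψ ≤ Ker toTheta` (root field `ker_toTheta`)
  have hker : D.DtpY ⊓ ((QuotientGroup.mk' K₃).comp D.toHat.toMonoidHom).ker ≤ D.toTheta.ker := by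
    rw [D.ker_toTheta]
    intro g hg
    have hg₂ := (Subgroup.mem_inf.1 hg).2
    rw [MonoidHom.mem_ker, MonoidHom.comp_apply, QuotientGroup.mk'_apply,
      QuotientGroup.eq_one_iff] at hg₂
    rw [Subgroup.mem_comap]
    exact hg₂
  exact hT.isCompact_map_of_isClosed_map D.DtpY D.isClosed_dtpY _ hψc himg D.toTheta
    D.continuous_toTheta hker

/-- **`Δ_Θ` is compact** (the binder `hΔ : IsCompact Δ_Θ` of the [IUTchII] model files; [EtTh] p. 12
«`(Ẑ(1) ≅) Δ_Θ`»): from `Π^tp_X` tempered first-countable and `hYcl` — again for the abstract topology of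
`(Π^tp_X)^Θ`.  Here `Δ_Θ = θ(ι⁻¹[Δ_X,Δ_X]⁻)` (root field `ker_toEll`) and the image of `ι⁻¹[Δ_X,Δ_X]⁻` in
`Π_X/[[Δ_X,Δ_X],Δ_X]⁻` is all of `[Δ_X,Δ_X]⁻/[[Δ_X,Δ_X],Δ_X]⁻`, because
`[Δ_X,Δ_X]⁻ ≤ (ι Δ^tp_Y)⁻ ≤ ι Δ^tp_Y ⊔ [[Δ_X,Δ_X],Δ_X]⁻` (`hYcl`). [cite: MochizukiEtTh2009, §1 p.12] -/
theorem isCompact_deltaTheta_of_closure_map_dtpY_le (hT : IsTempered D.PiTemp)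
    [FirstCountableTopology D.PiTemp]
    (hYcl : (D.DtpY.map D.toHat.toMonoidHom).topologicalClosure ≤
      D.DtpY.map D.toHat.toMonoidHom ⊔ (⁅⁅D.DeltaHat, D.DeltaHat⁆, D.DeltaHat⁆).topologicalClosure) :
    IsCompact ((D.DeltaTheta : Subgroup D.GtpTheta) : Set D.GtpTheta) := by
  haveI : CompactSpace D.PiHat := D.isProfiniteCompletion_toHat.compactSpace
  haveI : T2Space D.PiHat := D.isProfiniteCompletion_toHat.t2Space
  haveI hΔn : D.DeltaHat.Normal := SettingCompletion.deltaHat_normal D.toTemperedCurve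
  haveI hK₃n : (⁅⁅D.DeltaHat, D.DeltaHat⁆, D.DeltaHat⁆).topologicalClosure.Normal :=
    Subgroup.is_normal_topologicalClosure _
  haveI hK₃c : IsClosed
      (((⁅⁅D.DeltaHat, D.DeltaHat⁆, D.DeltaHat⁆).topologicalClosure : Subgroup D.PiHat) : Set D.PiHat) :=
    Subgroup.isClosed_topologicalClosure _
  have hK₃C₂ : (⁅⁅D.DeltaHat, D.DeltaHat⁆, D.DeltaHat⁆).topologicalClosure ≤
      (⁅D.DeltaHat, D.DeltaHat⁆).topologicalClosure :=
    Subgroup.topologicalClosure_mono (Subgroup.commutator_le_left _ _)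
  set K₃ := (⁅⁅D.DeltaHat, D.DeltaHat⁆, D.DeltaHat⁆).topologicalClosure with hK₃
  set C₂ := (⁅D.DeltaHat, D.DeltaHat⁆).topologicalClosure with hC₂
  have hC₂c : IsClosed ((C₂ : Subgroup D.PiHat) : Set D.PiHat) := by
    rw [hC₂]; exact Subgroup.isClosed_topologicalClosure _
  -- `K₂ := ι⁻¹ C₂`, a closed subgroup of `Π^tp_X`
  have hK₂c : IsClosed (((C₂.comap D.toHat.toMonoidHom : Subgroup D.PiTemp)) : Set D.PiTemp) := by
    rw [Subgroup.coe_comap]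
    exact hC₂c.preimage D.toHat.continuous
  -- `ψ : Π^tp_X → Π_X/K₃`
  have hψc : Continuous ((QuotientGroup.mk' K₃).comp D.toHat.toMonoidHom) :=
    QuotientGroup.continuous_mk.comp D.toHat.continuous
  -- `C₂ ≤ ι(Π^tp_X) ⊔ K₃` (density + `hYcl`)
  have hC₂le : C₂ ≤ D.toHat.toMonoidHom.range ⊔ K₃ :=
    calc C₂ ≤ (D.DtpY.map D.toHat.toMonoidHom).topologicalClosure :=
          D.commutatorClosure_deltaHat_le_closure_map_dtpY
      _ ≤ D.DtpY.map D.toHat.toMonoidHom ⊔ K₃ := hYcl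
      _ ≤ D.toHat.toMonoidHom.range ⊔ K₃ := sup_le_sup_right (Subgroup.map_le_range _ _) _
  -- hence `ι(K₂) ⊔ K₃ = C₂`
  have heq : (C₂.comap D.toHat.toMonoidHom).map D.toHat.toMonoidHom ⊔ K₃ = C₂ := by
    refine le_antisymm (sup_le (Subgroup.map_comap_le _ _) hK₃C₂) fun c hc => ?_
    -- Dedekind's law by hand (`K₃` normal): `c = x * y`, `x ∈ ι(Π^tp_X)`, `y ∈ K₃ ≤ C₂`
    have hc' : c ∈ (((D.toHat.toMonoidHom.range ⊔ K₃ : Subgroup D.PiHat)) : Set D.PiHat) := hC₂le hc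
    rw [Subgroup.mul_normal] at hc'
    obtain ⟨x, hx, y, hy, hxy⟩ := Set.mem_mul.1 hc'
    have hxC : x ∈ C₂ := by
      have hx' : x = c * y⁻¹ := by rw [← hxy, mul_inv_cancel_right]
      rw [hx']
      exact C₂.mul_mem hc (C₂.inv_mem (hK₃C₂ hy))
    have hxM : x ∈ (C₂.comap D.toHat.toMonoidHom).map D.toHat.toMonoidHom := by
      rw [Subgroup.map_comap_eq]
      exact Subgroup.mem_inf.2 ⟨hx, hxC⟩
    rw [← hxy]
    exact Subgroup.mul_mem_sup hxM hy
  -- so `ψ(K₂)` is closed in `Π_X/K₃`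
  have himg : IsClosed ((((C₂.comap D.toHat.toMonoidHom).map
      ((QuotientGroup.mk' K₃).comp D.toHat.toMonoidHom) : Subgroup (D.PiHat ⧸ K₃))) :
      Set (D.PiHat ⧸ K₃)) := by
    have h1 : ((((C₂.comap D.toHat.toMonoidHom).map
        ((QuotientGroup.mk' K₃).comp D.toHat.toMonoidHom) : Subgroup (D.PiHat ⧸ K₃))) :
        Set (D.PiHat ⧸ K₃)) =
        QuotientGroup.mk '' ((((C₂.comap D.toHat.toMonoidHom).map D.toHat.toMonoidHom :
          Subgroup D.PiHat)) : Set D.PiHat) := by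
      rw [← Subgroup.map_map, Subgroup.coe_map]
      rfl
    rw [h1, ← (QuotientGroup.isQuotientMap_mk K₃).isClosed_preimage,
      QuotientGroup.preimage_image_mk_eq_mul, ← Subgroup.mul_normal, heq]
    exact hC₂c
  -- `K₂ ∩ Ker ψ ≤ Ker toTheta`
  have hker : C₂.comap D.toHat.toMonoidHom ⊓ ((QuotientGroup.mk' K₃).comp D.toHat.toMonoidHom).ker ≤
      D.toTheta.ker := by
    rw [D.ker_toTheta]
    intro g hg
    have hg₂ := (Subgroup.mem_inf.1 hg).2
    rw [MonoidHom.mem_ker, MonoidHom.comp_apply, QuotientGroup.mk'_apply,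
      QuotientGroup.eq_one_iff] at hg₂
    rw [Subgroup.mem_comap]
    exact hg₂
  have hc := hT.isCompact_map_of_isClosed_map _ hK₂c _ hψc himg D.toTheta D.continuous_toTheta hker
  -- `θ(K₂) = Δ_Θ`
  have hΘ : (C₂.comap D.toHat.toMonoidHom).map D.toTheta = D.DeltaTheta := by
    have h2 : C₂.comap D.toHat.toMonoidHom = D.thetaToEll.ker.comap D.toTheta := by
      rw [MonoidHom.comap_ker, D.ker_toEll]
    rw [h2, Subgroup.map_comap_eq_self_of_surjective D.toTheta_surjective]
    rfl
  rw [hΘ] at hc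
  exact hc

/-! ### Hausdorffness of `(Π^tp_X)^Θ`, `(Π^tp_X)^ell` from the quotient-topology clause R3 -/

/-- If `toTheta : Π^tp_X ↠ (Π^tp_X)^Θ` is a topological quotient map (clause R3,
`IsThm16Origin.isQuotientMap_toTheta`), then `(Π^tp_X)^Θ` is HAUSDORFF: its kernel
`ι⁻¹[[Δ_X,Δ_X],Δ_X]⁻` (root field `ker_toTheta`) is closed. [cite: MochizukiEtTh2009, §1 p.12] -/
theorem t2Space_gtpTheta_of_isQuotientMap (hq : IsQuotientMap D.toTheta) : T2Space D.GtpTheta := by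
  rw [IsTopologicalGroup.t2Space_iff_one_closed, ← hq.isClosed_preimage]
  have h : D.toTheta ⁻¹' {1} = ((D.toTheta.ker : Subgroup D.PiTemp) : Set D.PiTemp) := by
    ext g
    simp [MonoidHom.mem_ker]
  rw [h, D.ker_toTheta, Subgroup.coe_comap]
  exact (Subgroup.isClosed_topologicalClosure _).preimage D.toHat.continuous

/-- If both `toTheta` and `thetaToEll` are quotient maps (clause R3), then `(Π^tp_X)^ell` is HAUSDORFF
(kernel `ι⁻¹[Δ_X,Δ_X]⁻`, root field `ker_toEll`). [cite: MochizukiEtTh2009, §1 p.12] -/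
theorem t2Space_gtpEll_of_isQuotientMap (hq : IsQuotientMap D.toTheta)
    (hq' : IsQuotientMap D.thetaToEll) : T2Space D.GtpEll := by
  rw [IsTopologicalGroup.t2Space_iff_one_closed, ← (hq'.comp hq).isClosed_preimage]
  have h : (D.thetaToEll ∘ D.toTheta) ⁻¹' {1} =
      (((D.thetaToEll.comp D.toTheta).ker : Subgroup D.PiTemp) : Set D.PiTemp) := by
    ext g
    simp [MonoidHom.mem_ker]
  rw [h, D.ker_toEll, Subgroup.coe_comap]
  exact (Subgroup.isClosed_topologicalClosure _).preimage D.toHat.continuous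

/-- Under R3, `Δ_Θ = Ker((Π^tp_X)^Θ ↠ (Π^tp_X)^ell)` is closed in `(Π^tp_X)^Θ`. [cite: MochizukiEtTh2009, §1 p.12] -/
theorem isClosed_deltaTheta_of_isQuotientMap (hq : IsQuotientMap D.toTheta)
    (hq' : IsQuotientMap D.thetaToEll) :
    IsClosed ((D.DeltaTheta : Subgroup D.GtpTheta) : Set D.GtpTheta) := by
  haveI := D.t2Space_gtpEll_of_isQuotientMap hq hq'
  change IsClosed ((D.thetaToEll : D.GtpTheta → D.GtpEll) ⁻¹' {1})
  exact isClosed_singleton.preimage D.continuous_thetaToEll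

/-! ### Packaging: the §6 parameter bundle, the origin clauses, the equivalence -/

/-- With the §6 parameter bundle `d` (ruling η′: `Π^tp_X` tempered, Galois-countable) and `hYcl`:
`(Δ^tp_Y)^Θ` is compact. [cite: MochizukiEtTh2009, §1 p.12] -/
theorem isCompact_dtpYTheta_of_groupLevelData (d : D.toTemperedCurve.GroupLevelData)
    (hYcl : (D.DtpY.map D.toHat.toMonoidHom).topologicalClosure ≤
      D.DtpY.map D.toHat.toMonoidHom ⊔ (⁅⁅D.DeltaHat, D.DeltaHat⁆, D.DeltaHat⁆).topologicalClosure) :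
    IsCompact ((D.DtpYTheta : Subgroup D.GtpTheta) : Set D.GtpTheta) := by
  haveI := d.secondCountableTopology
  exact D.isCompact_dtpYTheta_of_closure_map_dtpY_le d.isTempered hYcl

/-- With the §6 parameter bundle `d` and `hYcl`: **`Δ_Θ` is compact** — the binder `hΔ` of
`IotaInvariantThetaInftyDivisible.exists_root_lDeltaTheta` & co. (GAP row G-w5d187-1) DISCHARGED from
G-w4d021-2. [cite: MochizukiEtTh2009, §1 p.12] -/
theorem isCompact_deltaTheta_of_groupLevelData (d : D.toTemperedCurve.GroupLevelData)
    (hYcl : (D.DtpY.map D.toHat.toMonoidHom).topologicalClosure ≤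
      D.DtpY.map D.toHat.toMonoidHom ⊔ (⁅⁅D.DeltaHat, D.DeltaHat⁆, D.DeltaHat⁆).topologicalClosure) :
    IsCompact ((D.DeltaTheta : Subgroup D.GtpTheta) : Set D.GtpTheta) := by
  haveI := d.secondCountableTopology
  exact D.isCompact_deltaTheta_of_closure_map_dtpY_le d.isTempered hYcl

/-- **The two root-clause candidates agree.**  For `Π^tp_X` tempered first-countable and `toTheta` a
quotient map (R3): `hYcl` («the image of `Δ^tp_Y` in `Δ^Θ_X` is closed», `Π_X`-side) holds IFF
`(Δ^tp_Y)^Θ ⊆ (Π^tp_X)^Θ` is compact (`Θ`-side; [EtTh] p. 12 «abelian profinite groups») — this file's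
`isCompact_dtpYTheta_of_closure_map_dtpY_le` with abc-iut-L5-t14's `closure_map_dtpY_le_of_isQuotientMap`.
[cite: MochizukiEtTh2009, §1 p.12] -/
theorem closure_map_dtpY_le_iff_isCompact_dtpYTheta (hT : IsTempered D.PiTemp)
    [FirstCountableTopology D.PiTemp] (hq : IsQuotientMap D.toTheta) :
    (D.DtpY.map D.toHat.toMonoidHom).topologicalClosure ≤
        D.DtpY.map D.toHat.toMonoidHom ⊔ (⁅⁅D.DeltaHat, D.DeltaHat⁆, D.DeltaHat⁆).topologicalClosure ↔
      IsCompact ((D.DtpYTheta : Subgroup D.GtpTheta) : Set D.GtpTheta) :=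
  ⟨D.isCompact_dtpYTheta_of_closure_map_dtpY_le hT, D.closure_map_dtpY_le_of_isQuotientMap hq⟩

/-- The same equivalence with the §6 parameter bundle. [cite: MochizukiEtTh2009, §1 p.12] -/
theorem closure_map_dtpY_le_iff_isCompact_dtpYTheta_of_groupLevelData
    (d : D.toTemperedCurve.GroupLevelData) (hq : IsQuotientMap D.toTheta) :
    (D.DtpY.map D.toHat.toMonoidHom).topologicalClosure ≤
        D.DtpY.map D.toHat.toMonoidHom ⊔ (⁅⁅D.DeltaHat, D.DeltaHat⁆, D.DeltaHat⁆).topologicalClosure ↔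
      IsCompact ((D.DtpYTheta : Subgroup D.GtpTheta) : Set D.GtpTheta) := by
  haveI := d.secondCountableTopology
  exact D.closure_map_dtpY_le_iff_isCompact_dtpYTheta d.isTempered hq

end ThetaSetting

end Literature.AnabelianGeometry.EtaleTheta

end
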